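import Summits.Ventures.YMGap.RobustBall.CentreTubeMembers
import Summits.Ventures.YMGap.RobustBall.StringTensionCentreBlind
import HarnessLib

/-!
# Robust ball (Y2) — STRING TENSION ON THE CENTRE TUBE: the infinite-volume form of the centre-tube area law

HONEST FRAMING: venture file of the cell `pub-ymgap` (QuantumFields programme), track ROBUST-BALL / DS seat ds-4 (g8).
Strong-coupling LATTICE statements; nothing about the continuum, a spectral mass gap, or Clay.

WHAT.  `CentreTubeAreaLaw` proves the torus area law `AreaLawCentreTube N d β a` for every `N ≥ 2`, `0 ≤ a` and
`2(d−1)(N|β| + a) < 1`: ONE pair `(C, c) = (2, −log max(2(d−1)(N|β| + a), 1/2))` bounds `|⟨W_{R×T}⟩_{β,W,L}| ≤ C^{2(R+T)} e^{−cRT}` for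
EVERY torus `L` and EVERY flux-local perturbation `W` of amplitude `a` (`IsFluxLocal a W`: a twist-invariant part of ANY size plus a
plaquette-flux-local twist defect `≤ a`).  Exactly as gen 7's file 12 (`StringTensionCentreBlind`, schema = rb-p2's
`hasAreaLawWith_of_torusBound` verbatim), the volume-uniform bound passes to every INFINITE-VOLUME LIMIT STATE
(`perturbedLimitPoints β 𝓦`, non-empty by compactness) of every family `𝓦` that is eventually flux-local with amplitude `a`,
in the tree's `ℤ^d` currencies (`Literature/MathematicalPhysics/QuantumLattice/WilsonLoops.lean`):
* `hasAreaLawWith_centreTube` / `stringTension_centreTube` — from the currency `AreaLawCentreTube N d β a` (`d ≥ 2`): every limit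
  state `μ` obeys `HasAreaLawWith μ χ_N C c`, hence `HasAreaLawState μ χ_N`, `σ ≥ c` WHENEVER the string tension exists, and
  `IsConfining μ χ_N` given existence;
* `stringTension_fluxLocal` — unconditionally with the explicit constants, `N ≥ 2`, `d ≥ 2`, `0 ≤ a`, `2(d−1)(N|β| + a) < 1`;
* ★ `stringTension_bondDisorder` — BOND DISORDER, UNIFORMLY IN THE COUPLING FIELD: one rate `c = −log max(2(d−1)N(|β| + δ), 1/2)` for
  EVERY family whose member at torus size `L` is a twist-blind action (any size) plus the detuned Wilson couplings `β + δ^{(L)}_q`,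
  `|δ^{(L)}_q| ≤ δ` (an arbitrary coupling field per volume); such families EXIST (`exists_bondDisorder_family`) and have limit states;
* rows: SU(2), `d = 4`, `2|β| + a < 1/6`.
WHAT IS NOT CLAIMED.  EXISTENCE of the string tension of a limit state of a perturbed family (no reflection positivity for a general
member; bond disorder breaks translation invariance too) — every string-tension clause is «whenever it exists»; the unconditional
content is `HasAreaLawWith` of every limit state.  Window smaller than tier 1's; tube open only in single-plaquette flux directions
(`CentreTubeAreaLaw`).  Loops: rectangles in the `(0,1)` plane based at the origin (the tree's currency).

References (mechanism, AS PRINTED): J. Fröhlich, Phys. Lett. B 83 (1979) 195–198 [Frohlich1979ZN]; G. Mack, V. B. Petkova,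
Ann. Phys. 123 (1979) 442–467 [MackPetkova1979]; E. Seiler, LNP 159 (1982) §2 for the string-tension notions.
-/

noncomputable section

open MeasureTheory Filter Topology
open Literature.MathematicalPhysics.QuantumLattice
open Literature.MathematicalPhysics.QuantumFieldTheory hiding ZdEdge Site
open Literature.Barriers.QuantumFields (suFundStringTension suFundStringTension_def)

namespace Summit.Ventures.YMGap.RobustBall

variable {d L N : ℕ}

/-! ### From the currency `AreaLawCentreTube` -/

/-- **CENTRE-TUBE AREA LAW ⇒ `ℤ^d` AREA LAW OF EVERY LIMIT STATE, SAME CONSTANTS.**  If `AreaLawCentreTube N d β a` (`d ≥ 2`),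
there are `C` and `c > 0` such that for every family `𝓦` whose members are, for all large torus sizes, flux-local with amplitude
`a`, every infinite-volume limit state `μ ∈ perturbedLimitPoints β 𝓦` satisfies `HasAreaLawWith μ χ_N C c`. [folklore] -/
theorem hasAreaLawWith_centreTube [NeZero d] [NeZero N] (hd : 2 ≤ d) {β a : ℝ} (h : AreaLawCentreTube N d β a) :
    ∃ C c : ℝ, 0 < c ∧ ∀ 𝓦 : PerturbationFamily d N,
      (∀ᶠ L : ℕ in atTop, IsFluxLocal a (𝓦 L)) →
        ∀ μ ∈ perturbedLimitPoints β 𝓦,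
          HasAreaLawWith μ (fun g => normalisedCharacter N (fundamentalRep (Fin N) g)) C c := by
  obtain ⟨C, c, hc, hA⟩ := h
  refine ⟨C, c, hc, fun 𝓦 h𝓦 μ hμ => hasAreaLawWith_of_torusBound (β := β)
    (fun L => {W : Perturbation d (L + 1) N | IsFluxLocal a W}) (fun L W hW R T hR hT hRL hTL => ?_) 𝓦
    (h𝓦.mono fun L hL => hL) hμ⟩
  exact hA (L + 1) W hW 0 0 1 R T (fin_zero_ne_one_of_two_le hd) hR hT hRL hTL

/-- **STRING TENSION ON THE CENTRE TUBE.**  Under `AreaLawCentreTube N d β a` (`d ≥ 2`) there is ONE pair `(C, c)`, `c > 0`, such that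
every infinite-volume limit state `μ` of every eventually-flux-local family of amplitude `a`: (i) obeys `HasAreaLawWith μ χ_N C c`
(so `HasAreaLawState μ χ_N`); (ii) has string tension `σ ≥ c` WHENEVER the string tension exists; (iii) is confining
(`IsConfining μ χ_N`) as soon as its string tension exists.  Existence of `σ` is NOT asserted. [folklore] -/
theorem stringTension_centreTube [NeZero d] [NeZero N] (hd : 2 ≤ d) {β a : ℝ} (h : AreaLawCentreTube N d β a) :
    ∃ C c : ℝ, 0 < c ∧ ∀ 𝓦 : PerturbationFamily d N,
      (∀ᶠ L : ℕ in atTop, IsFluxLocal a (𝓦 L)) →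
        ∀ μ ∈ perturbedLimitPoints β 𝓦,
          HasAreaLawWith μ (fun g => normalisedCharacter N (fundamentalRep (Fin N) g)) C c ∧
          HasAreaLawState μ (fun g => normalisedCharacter N (fundamentalRep (Fin N) g)) ∧
          (∀ σ : ℝ, HasStringTension μ (fun g => normalisedCharacter N (fundamentalRep (Fin N) g)) σ → c ≤ σ) ∧
          ((∃ σ : ℝ, HasStringTension μ (fun g => normalisedCharacter N (fundamentalRep (Fin N) g)) σ) →
            IsConfining μ (fun g => normalisedCharacter N (fundamentalRep (Fin N) g))) := by
  obtain ⟨C, c, hc, hA⟩ := hasAreaLawWith_centreTube hd h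
  refine ⟨C, c, hc, fun 𝓦 h𝓦 μ hμ => ?_⟩
  have hW := hA 𝓦 h𝓦 μ hμ
  exact ⟨hW, ⟨C, c, hc, hW⟩, fun σ hσ => hW.le_of_hasStringTension hσ,
    fun hσ => HasAreaLawState.isConfining ⟨C, c, hc, hW⟩ hσ⟩

/-- The `d = 4` reading in the tree's named string tension `suFundStringTension N μ`: under `AreaLawCentreTube N 4 β a`, one
`c > 0` bounds from below the fundamental string tension of every limit state of every eventually-flux-local family of amplitude `a`
whose string tension exists. [folklore] -/
theorem suFundStringTension_ge_centreTube [NeZero N] {β a : ℝ} (h : AreaLawCentreTube N 4 β a) :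
    ∃ C c : ℝ, 0 < c ∧ ∀ 𝓦 : PerturbationFamily 4 N,
      (∀ᶠ L : ℕ in atTop, IsFluxLocal a (𝓦 L)) →
        ∀ μ ∈ perturbedLimitPoints β 𝓦,
          HasAreaLawWith μ (fun g => normalisedCharacter N (fundamentalRep (Fin N) g)) C c ∧
          ((∃ σ : ℝ, HasStringTension μ (fun g => normalisedCharacter N (fundamentalRep (Fin N) g)) σ) →
            c ≤ suFundStringTension N μ) := by
  obtain ⟨C, c, hc, hA⟩ := hasAreaLawWith_centreTube (N := N) (by norm_num) h
  refine ⟨C, c, hc, fun 𝓦 h𝓦 μ hμ => ⟨hA 𝓦 h𝓦 μ hμ, fun ⟨σ, hσ⟩ => ?_⟩⟩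
  rw [suFundStringTension_def, hσ.stringTension_eq]
  exact (hA 𝓦 h𝓦 μ hμ).le_of_hasStringTension hσ

/-! ### Unconditionally, with the explicit constants -/

/-- **STRING TENSION OF FLUX-LOCAL FAMILIES, explicit constants** (`N ≥ 2`, `d ≥ 2`, `0 ≤ a`, `c₀ = 2(d−1)(N|β| + a) < 1`; `C = 2`,
`c = −log max(c₀, 1/2) > 0`): every infinite-volume limit state `μ` of every family that is eventually flux-local with amplitude `a`
obeys `HasAreaLawWith μ χ_N 2 c`, and `σ ≥ c` whenever its string tension `σ` exists. [folklore] -/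
theorem stringTension_fluxLocal [NeZero d] [NeZero N] (hd : 2 ≤ d) (hN : 2 ≤ N) {β a : ℝ} (ha : 0 ≤ a)
    (hβ : 2 * ((d - 1 : ℕ) : ℝ) * (|β| * N + a) < 1) :
    ∀ 𝓦 : PerturbationFamily d N, (∀ᶠ L : ℕ in atTop, IsFluxLocal a (𝓦 L)) →
      ∀ μ ∈ perturbedLimitPoints β 𝓦,
        HasAreaLawWith μ (fun g => normalisedCharacter N (fundamentalRep (Fin N) g)) 2
            (-Real.log (max (2 * ((d - 1 : ℕ) : ℝ) * (|β| * N + a)) (1 / 2))) ∧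
        (∀ σ : ℝ, HasStringTension μ (fun g => normalisedCharacter N (fundamentalRep (Fin N) g)) σ →
            -Real.log (max (2 * ((d - 1 : ℕ) : ℝ) * (|β| * N + a)) (1 / 2)) ≤ σ) ∧
        ((∃ σ : ℝ, HasStringTension μ (fun g => normalisedCharacter N (fundamentalRep (Fin N) g)) σ) →
            IsConfining μ (fun g => normalisedCharacter N (fundamentalRep (Fin N) g))) := by
  set c := max (2 * ((d - 1 : ℕ) : ℝ) * (|β| * N + a)) (1 / 2) with hcdef
  have hc0 : 0 < c := lt_max_of_lt_right (by norm_num)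
  have hc1 : c < 1 := max_lt hβ (by norm_num)
  have hcle : 2 * ((d - 1 : ℕ) : ℝ) * (|β| * N + a) ≤ c := le_max_left _ _
  have hpos : 0 < -Real.log c := neg_pos.2 (Real.log_neg hc0 hc1)
  intro 𝓦 h𝓦 μ hμ
  have hW : HasAreaLawWith μ (fun g => normalisedCharacter N (fundamentalRep (Fin N) g)) 2 (-Real.log c) :=
    hasAreaLawWith_of_torusBound (β := β) (fun L => {W : Perturbation d (L + 1) N | IsFluxLocal a W})
      (fun L W hW R T _ _ hRL hTL =>
        (abs_wilsonLoop_le_of_isFluxLocal hN ha hcle hc1.le W hW 0 (fin_zero_ne_one_of_two_le hd) hRL hTL).trans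
          (pow_bound_le_areaLawShape hc0 R T))
      𝓦 (h𝓦.mono fun L hL => hL) hμ
  exact ⟨hW, fun σ hσ => hW.le_of_hasStringTension hσ,
    fun hσ => HasAreaLawState.isConfining ⟨2, -Real.log c, hpos, hW⟩ hσ⟩

/-! ### Bond disorder, uniformly in the coupling field -/

/-- **BOND-DISORDERED FAMILIES EXIST**: for every sequence of coupling fields `δ^{(L)} : plaquettes of the torus `L+1` → ℝ` with
`|δ^{(L)}_q| ≤ δ₀` (`0 ≤ δ₀`) there is a family whose member at EVERY torus size is a plaquette family action of the detuning
densities `−δ^{(L)}_q Re tr U_q`. [folklore] -/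
theorem exists_bondDisorder_family [NeZero N] {δ₀ : ℝ} (hδ₀ : 0 ≤ δ₀) (δ : (L : ℕ) → Plaquette d (L + 1) → ℝ)
    (hδ : ∀ L q, |δ L q| ≤ δ₀) :
    ∃ 𝓦 : PerturbationFamily d N, ∀ L, IsPlaquetteFamilyAction (detuneDensity (δ L)) (𝓦 L) := by
  classical
  exact ⟨fun L => Classical.choose (exists_detune_member (N := N) (L := L + 1) hδ₀ (hδ L)),
    fun L => Classical.choose_spec (exists_detune_member (N := N) (L := L + 1) hδ₀ (hδ L))⟩

/-- **STRING TENSION UNDER BOND DISORDER, UNIFORMLY IN THE COUPLING FIELD** (`N ≥ 2`, `d ≥ 2`, `0 ≤ δ`,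
`c₀ = 2(d−1)N(|β| + δ) < 1`, `c = −log max(c₀, 1/2) > 0`): for EVERY family whose member at each large torus size is a twist-blind
action (e.g. adjoint couplings of any strength) PLUS a detuned Wilson action with an ARBITRARY coupling field `|δ^{(L)}_q| ≤ δ`, every
infinite-volume limit state obeys `HasAreaLawWith μ χ_N 2 c` and `σ ≥ c` whenever its string tension exists — one rate for all
coupling fields in the window. [folklore] -/
theorem stringTension_bondDisorder [NeZero d] [NeZero N] (hd : 2 ≤ d) (hN : 2 ≤ N) {β δ₀ : ℝ} (hδ₀ : 0 ≤ δ₀)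
    (hβ : 2 * ((d - 1 : ℕ) : ℝ) * N * (|β| + δ₀) < 1) :
    ∀ 𝓦 : PerturbationFamily d N,
      (∀ᶠ L : ℕ in atTop, ∃ (Wb Wδ : Perturbation d (L + 1) N) (δ : Plaquette d (L + 1) → ℝ),
        IsTwistBlind Wb ∧ (∀ q, |δ q| ≤ δ₀) ∧ IsPlaquetteFamilyAction (detuneDensity δ) Wδ ∧ 𝓦 L = Wb + Wδ) →
      ∀ μ ∈ perturbedLimitPoints β 𝓦,
        HasAreaLawWith μ (fun g => normalisedCharacter N (fundamentalRep (Fin N) g)) 2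
            (-Real.log (max (2 * ((d - 1 : ℕ) : ℝ) * (|β| * N + N * δ₀)) (1 / 2))) ∧
        (∀ σ : ℝ, HasStringTension μ (fun g => normalisedCharacter N (fundamentalRep (Fin N) g)) σ →
            -Real.log (max (2 * ((d - 1 : ℕ) : ℝ) * (|β| * N + N * δ₀)) (1 / 2)) ≤ σ) := by
  intro 𝓦 h𝓦 μ hμ
  have hβ' : 2 * ((d - 1 : ℕ) : ℝ) * (|β| * N + N * δ₀) < 1 := by
    rw [show |β| * (N : ℝ) + N * δ₀ = N * (|β| + δ₀) by ring, ← mul_assoc]; exact hβ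
  have h := stringTension_fluxLocal hd hN (a := (N : ℝ) * δ₀) (by positivity) hβ' 𝓦 (h𝓦.mono fun L hL => ?_) μ hμ
  · exact ⟨h.1, h.2.1⟩
  · obtain ⟨Wb, Wδ, δ, hb, hδ, hW, hL⟩ := hL
    rw [hL]
    exact IsFluxLocal.twistBlind_add hb (isFluxLocal_of_detune hδ hW)

/-- **Bond-disordered families with twist-blind background exist and have confining limit states** (`N ≥ 2`, `d ≥ 2`,
`2(d−1)N(|β| + δ) < 1`): for every sequence of coupling fields `|δ^{(L)}_q| ≤ δ` and every sequence of twist-blind members `Wb^{(L)}`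
there is the family `Wb^{(L)} + W_{δ^{(L)}}`, its set of limit states is non-empty, and all of them obey `HasAreaLawWith μ χ_N 2 c`
with the field-independent rate. [folklore] -/
theorem exists_bondDisorder_family_confining [NeZero d] [NeZero N] (hd : 2 ≤ d) (hN : 2 ≤ N) {β δ₀ : ℝ} (hδ₀ : 0 ≤ δ₀)
    (hβ : 2 * ((d - 1 : ℕ) : ℝ) * N * (|β| + δ₀) < 1) (δ : (L : ℕ) → Plaquette d (L + 1) → ℝ)
    (hδ : ∀ L q, |δ L q| ≤ δ₀) (Wb : PerturbationFamily d N) (hb : ∀ L, IsTwistBlind (Wb L)) :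
    ∃ 𝓦 : PerturbationFamily d N,
      (∀ L, ∃ Wδ : Perturbation d (L + 1) N, IsPlaquetteFamilyAction (detuneDensity (δ L)) Wδ ∧ 𝓦 L = Wb L + Wδ) ∧
      (perturbedLimitPoints β 𝓦).Nonempty ∧
      0 < -Real.log (max (2 * ((d - 1 : ℕ) : ℝ) * (|β| * N + N * δ₀)) (1 / 2)) ∧
      ∀ μ ∈ perturbedLimitPoints β 𝓦,
        HasAreaLawWith μ (fun g => normalisedCharacter N (fundamentalRep (Fin N) g)) 2
            (-Real.log (max (2 * ((d - 1 : ℕ) : ℝ) * (|β| * N + N * δ₀)) (1 / 2))) := by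
  obtain ⟨𝓦δ, h𝓦δ⟩ := exists_bondDisorder_family (d := d) (N := N) hδ₀ δ hδ
  have hβ' : 2 * ((d - 1 : ℕ) : ℝ) * (|β| * N + N * δ₀) < 1 := by
    rw [show |β| * (N : ℝ) + N * δ₀ = N * (|β| + δ₀) by ring, ← mul_assoc]; exact hβ
  have hc0 : 0 < max (2 * ((d - 1 : ℕ) : ℝ) * (|β| * N + N * δ₀)) (1 / 2) := lt_max_of_lt_right (by norm_num)
  have hc1 : max (2 * ((d - 1 : ℕ) : ℝ) * (|β| * N + N * δ₀)) (1 / 2) < 1 := max_lt hβ' (by norm_num)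
  refine ⟨fun L => Wb L + 𝓦δ L, fun L => ⟨𝓦δ L, h𝓦δ L, rfl⟩, perturbedLimitPoints_nonempty β _,
    neg_pos.2 (Real.log_neg hc0 hc1), fun μ hμ => ?_⟩
  exact (stringTension_bondDisorder hd hN hδ₀ hβ _ (Filter.Eventually.of_forall fun L =>
    ⟨Wb L, 𝓦δ L, δ L, hb L, hδ L, h𝓦δ L, rfl⟩) μ hμ).1

/-! ### Rows -/

/-- **SU(2), `d = 4`, `2|β| + a < 1/6` (`β_W + a < 1/6`)**: every limit state of every eventually-flux-local family of amplitude `a`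
obeys `HasAreaLawWith μ χ₂ 2 c`, `c = −log max(6(2|β| + a), 1/2)`, and `c ≤ suFundStringTension 2 μ` whenever the string tension
exists. [folklore] -/
theorem su2_stringTension_fluxLocal_dim4 {β a : ℝ} (ha : 0 ≤ a) (hβ : 2 * |β| + a < 1 / 6) :
    ∀ 𝓦 : PerturbationFamily 4 2, (∀ᶠ L : ℕ in atTop, IsFluxLocal a (𝓦 L)) →
      ∀ μ ∈ perturbedLimitPoints β 𝓦,
        HasAreaLawWith μ (fun g => normalisedCharacter 2 (fundamentalRep (Fin 2) g)) 2
            (-Real.log (max (6 * (2 * |β| + a)) (1 / 2))) ∧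
        ((∃ σ : ℝ, HasStringTension μ (fun g => normalisedCharacter 2 (fundamentalRep (Fin 2) g)) σ) →
            -Real.log (max (6 * (2 * |β| + a)) (1 / 2)) ≤ suFundStringTension 2 μ) := by
  intro 𝓦 h𝓦 μ hμ
  have h := stringTension_fluxLocal (d := 4) (N := 2) (by norm_num) le_rfl (β := β) ha (by push_cast; linarith) 𝓦 h𝓦 μ hμ
  have e : (2 * ((4 - 1 : ℕ) : ℝ) * (|β| * (2 : ℕ) + a)) = 6 * (2 * |β| + a) := by push_cast; ring
  rw [e] at h
  refine ⟨h.1, fun ⟨σ, hσ⟩ => ?_⟩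
  rw [suFundStringTension_def, hσ.stringTension_eq]
  exact h.2.1 σ hσ

end Summit.Ventures.YMGap.RobustBall

end
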